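import Mathlib
import HarnessLib
import Literature.MathematicalPhysics.QuantumLattice.HeisenbergOrderNeelRiemann3
import Literature.MathematicalPhysics.QuantumLattice.KohnLuttingerLindhardMeasurable
import Summits.HubbardSuperconductivity.HubbardSuperconductivity.Theorems.ChiralWindowCwKLChiralWindowMuWindow

/-!
# Crux `CwChiralConstruction` (stmt-HubbardSuperconductivity-1740), line `ladder-scale-transfer`:
# stub `stub_fillingBelowSevenTenths`

For the nearest-neighbour band `ε₀ = squareDispersion 1 0` (`ε₀ p = -2 (cos p₀ + cos p₁)`) the
filling is `n(μ) = 2 vol({ε₀ < μ} ∩ BZ) / (2π)²` (`kl_mu_filling_eq`).  We prove the certified number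
`n(-21/25) < 7/10` (true value `0.6634`) by an octagon containment of the Fermi sea
`S = {ε₀ < -21/25} ∩ BZ = {cos p₀ + cos p₁ > 21/50, pᵢ ∈ [-π, π)}`:

* `|pᵢ| < 11/5`: `cos pᵢ > 21/50 - 1 = -29/50 ≥ cos (11/5)` (certified by the Taylor bound
  `KLSNumerics.cos_le_taylor_eight`) and `cos` is antitone on `[0, π]`;
* `|p₀| + |p₁| < 68/25`: with `a = |p₀|`, `b = |p₁| ∈ [0, π]`,
  `cos a + cos b = 2 cos ((a+b)/2) cos ((a-b)/2)`, `0 ≤ cos ((a-b)/2) ≤ 1`, and `a + b ≥ 68/25` would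
  give `cos ((a+b)/2) ≤ cos (34/25) ≤ 21/100` (Taylor bound again), whence `cos a + cos b ≤ 21/50`.

In the coordinates `(p₀, p₁) ∈ ℝ × ℝ` (a volume-preserving identification,
`measurePreserving_momentum_prod`) the octagon
`{|x| < 11/5, |y| < 11/5, |x| + |y| < 68/25}` is covered by the box `(-13/25, 13/25) × (-11/5, 11/5)`
and the two trapezoids `{13/25 ≤ ±x ≤ 11/5, |y| < 68/25 ∓ x}` (`regionBetween` of affine functions),
of total area `572/125 + 2 · 2856/625 = 8572/625 = 13.7152 < 1.4 π²` (`π > 3.1415`), which is the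
threshold for `n < 7/10`.  Folklore; no definitions.
-/

set_option linter.dupNamespace false

namespace Summit.HubbardSuperconductivity.HubbardSuperconductivity.Theorems

open MeasureTheory Literature.MathematicalPhysics.QuantumLattice

/-! ### Two certified cosine values -/

/-- `cos (11/5) ≤ -29/50` (the degree-eight Taylor upper bound at `11/5` is `-0.58779…`).
[folklore] -/
theorem klT_cos_eleven_fifths_le : Real.cos (11 / 5) ≤ -29 / 50 := by
  have h := KLSNumerics.cos_le_taylor_eight (x := 11 / 5) (by norm_num)
  refine h.trans ?_
  norm_num

/-- `cos (34/25) ≤ 21/100` (the degree-eight Taylor upper bound at `34/25` is `0.209244…`).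
[folklore] -/
theorem klT_cos_halfD_le : Real.cos (34 / 25) ≤ 21 / 100 := by
  have h := KLSNumerics.cos_le_taylor_eight (x := 34 / 25) (by norm_num)
  refine h.trans ?_
  norm_num

/-! ### The planar inequalities -/

/-- If `|x| ≤ π` and `cos x > -29/50` then `|x| < 11/5` (`cos` is even and antitone on `[0, π]`,
`cos (11/5) ≤ -29/50`). [folklore] -/
theorem klT_abs_lt {x : ℝ} (hx : |x| ≤ Real.pi) (hc : -29 / 50 < Real.cos x) : |x| < 11 / 5 := by
  rcases lt_or_ge |x| (11 / 5) with h | h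
  · exact h
  · exfalso
    have := Real.cos_le_cos_of_nonneg_of_le_pi (by norm_num) hx h
    rw [Real.cos_abs] at this
    linarith [klT_cos_eleven_fifths_le]

/-- For `a, b ∈ [0, π]` with `cos a + cos b > 21/50` one has `a + b < 68/25`
(`cos a + cos b = 2 cos ((a+b)/2) cos ((a-b)/2)` with `0 ≤ cos ((a-b)/2) ≤ 1`, and
`a + b ≥ 68/25` forces `cos ((a+b)/2) ≤ cos (34/25) ≤ 21/100`). [folklore] -/
theorem klT_add_lt {a b : ℝ} (ha0 : 0 ≤ a) (haπ : a ≤ Real.pi) (hb0 : 0 ≤ b) (hbπ : b ≤ Real.pi)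
    (h : 21 / 50 < Real.cos a + Real.cos b) : a + b < 68 / 25 := by
  rcases lt_or_ge (a + b) (68 / 25) with hD | hD
  · exact hD
  · exfalso
    rw [Real.cos_add_cos] at h
    have hu : Real.cos ((a + b) / 2) ≤ 21 / 100 :=
      (Real.cos_le_cos_of_nonneg_of_le_pi (by norm_num) (by linarith) (by linarith)).trans
        klT_cos_halfD_le
    have hv0 : 0 ≤ Real.cos ((a - b) / 2) :=
      Real.cos_nonneg_of_mem_Icc ⟨by linarith [Real.pi_pos], by linarith [Real.pi_pos]⟩
    have hv1 := Real.cos_le_one ((a - b) / 2)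
    nlinarith [mul_nonneg (sub_nonneg.2 hu) hv0]

/-- Octagon containment of the Fermi sea at energy `-21/25`, in coordinates: an occupied momentum
`p` of the Brillouin zone has `|p₀| < 11/5`, `|p₁| < 11/5` and `|p₀| + |p₁| < 68/25`. [folklore] -/
theorem klT_occupied_coords {p : Momentum}
    (hp : p ∈ {p : Momentum | squareDispersion 1 0 p < -(21:ℝ) / 25} ∩ brillouinZone) :
    |p 0| < 11 / 5 ∧ |p 1| < 11 / 5 ∧ |p 0| + |p 1| < 68 / 25 := by
  obtain ⟨hp1, hp2⟩ := hp
  simp only [Set.mem_setOf_eq, squareDispersion] at hp1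
  have hsum : 21 / 50 < Real.cos (p 0) + Real.cos (p 1) := by linarith
  have habs : ∀ i, |p i| ≤ Real.pi := fun i => by
    have := hp2 i
    rw [abs_le]
    exact ⟨this.1, this.2.le⟩
  refine ⟨klT_abs_lt (habs 0) (by linarith [Real.cos_le_one (p 1)]),
    klT_abs_lt (habs 1) (by linarith [Real.cos_le_one (p 0)]), ?_⟩
  rw [← Real.cos_abs (p 0), ← Real.cos_abs (p 1)] at hsum
  exact klT_add_lt (abs_nonneg _) (habs 0) (abs_nonneg _) (habs 1) hsum

/-! ### The octagon: three pieces in `ℝ × ℝ` and their areas -/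

/-- The Fermi sea at energy `-21/25`, read in the coordinates `(p₀, p₁)`, lies in the union of the
box `(-13/25, 13/25) × (-11/5, 11/5)` and the two trapezoids `{13/25 ≤ x ≤ 11/5, |y| < 68/25 - x}`,
`{-11/5 ≤ x ≤ -13/25, |y| < 68/25 + x}`. [folklore] -/
theorem klT_occupied_subset_preimage :
    {p : Momentum | squareDispersion 1 0 p < -(21:ℝ) / 25} ∩ brillouinZone ⊆
      (fun k : Momentum => ((k 0, k 1) : ℝ × ℝ)) ⁻¹'
        ((Set.Ioo (-(13 / 25 : ℝ)) (13 / 25) ×ˢ Set.Ioo (-(11 / 5 : ℝ)) (11 / 5)) ∪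
          regionBetween (fun x : ℝ => x - 68 / 25) (fun x => 68 / 25 - x)
            (Set.Icc (13 / 25) (11 / 5)) ∪
          regionBetween (fun x : ℝ => -x - 68 / 25) (fun x => x + 68 / 25)
            (Set.Icc (-(11 / 5)) (-(13 / 25)))) := by
  intro p hp
  obtain ⟨h0, h1, hs⟩ := klT_occupied_coords hp
  rw [abs_lt] at h0 h1
  simp only [Set.mem_preimage, Set.mem_union, Set.mem_prod, Set.mem_Ioo, regionBetween,
    Set.mem_setOf_eq, Set.mem_Icc]
  rcases le_or_gt (p 0) (-(13 / 25)) with hlo | hlo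
  · -- left trapezoid
    right
    rw [abs_of_neg (by linarith)] at hs
    have := abs_lt.1 (show |p 1| < 68 / 25 + p 0 by linarith)
    exact ⟨⟨by linarith, by linarith⟩, by linarith, by linarith⟩
  rcases le_or_gt (13 / 25) (p 0) with hhi | hhi
  · -- right trapezoid
    left; right
    rw [abs_of_pos (by linarith)] at hs
    have := abs_lt.1 (show |p 1| < 68 / 25 - p 0 by linarith)
    exact ⟨⟨by linarith, by linarith⟩, by linarith, by linarith⟩
  · -- central box
    left; left
    exact ⟨⟨by linarith, by linarith⟩, by linarith, by linarith⟩

/-- The union of the three pieces is measurable. [folklore] -/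
theorem klT_measurableSet_pieces :
    MeasurableSet
      ((Set.Ioo (-(13 / 25 : ℝ)) (13 / 25) ×ˢ Set.Ioo (-(11 / 5 : ℝ)) (11 / 5)) ∪
        regionBetween (fun x : ℝ => x - 68 / 25) (fun x => 68 / 25 - x)
          (Set.Icc (13 / 25) (11 / 5)) ∪
        regionBetween (fun x : ℝ => -x - 68 / 25) (fun x => x + 68 / 25)
          (Set.Icc (-(11 / 5)) (-(13 / 25)))) := by
  refine ((measurableSet_Ioo.prod measurableSet_Ioo).union ?_).union ?_
  · exact measurableSet_regionBetween (by fun_prop) (by fun_prop) measurableSet_Icc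
  · exact measurableSet_regionBetween (by fun_prop) (by fun_prop) measurableSet_Icc

/-- Area of the central box: `(26/25) · (22/5) = 572/125`. [folklore] -/
theorem klT_volume_box :
    volume (Set.Ioo (-(13 / 25 : ℝ)) (13 / 25) ×ˢ Set.Ioo (-(11 / 5 : ℝ)) (11 / 5)) =
      ENNReal.ofReal (572 / 125) := by
  rw [Measure.volume_eq_prod, Measure.prod_prod, Real.volume_Ioo, Real.volume_Ioo,
    ← ENNReal.ofReal_mul (by norm_num)]
  congr 1
  norm_num

/-- `∫_{13/25}^{11/5} (136/25 - 2x) dx = 2856/625`. [folklore] -/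
theorem klT_integral_right :
    ∫ x in (13 / 25 : ℝ)..(11 / 5), ((136 / 25 : ℝ) - 2 * x) = 2856 / 625 := by
  rw [intervalIntegral.integral_sub intervalIntegrable_const
      (Continuous.intervalIntegrable (by fun_prop) _ _),
    intervalIntegral.integral_const, intervalIntegral.integral_const_mul, integral_id]
  norm_num

/-- `∫_{-11/5}^{-13/25} (136/25 + 2x) dx = 2856/625`. [folklore] -/
theorem klT_integral_left :
    ∫ x in (-(11 / 5) : ℝ)..(-(13 / 25)), ((136 / 25 : ℝ) + 2 * x) = 2856 / 625 := by
  rw [intervalIntegral.integral_add intervalIntegrable_const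
      (Continuous.intervalIntegrable (by fun_prop) _ _),
    intervalIntegral.integral_const, intervalIntegral.integral_const_mul, integral_id]
  norm_num

/-- Area of the right trapezoid `{13/25 ≤ x ≤ 11/5, |y| < 68/25 - x}`: `2856/625`. [folklore] -/
theorem klT_volume_right :
    volume (regionBetween (fun x : ℝ => x - 68 / 25) (fun x => 68 / 25 - x)
      (Set.Icc (13 / 25) (11 / 5))) = ENNReal.ofReal (2856 / 625) := by
  rw [Measure.volume_eq_prod, volume_regionBetween_eq_integral
    (Continuous.integrableOn_Icc (by fun_prop)) (Continuous.integrableOn_Icc (by fun_prop))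
    measurableSet_Icc (fun x hx => by simp only [Set.mem_Icc] at hx; linarith)]
  congr 1
  have hfun : ((fun x : ℝ => 68 / 25 - x) - fun x : ℝ => x - 68 / 25) =
      fun x => (136 / 25 : ℝ) - 2 * x := by
    funext x
    simp only [Pi.sub_apply]
    ring
  rw [hfun, integral_Icc_eq_integral_Ioc, ← intervalIntegral.integral_of_le (by norm_num),
    klT_integral_right]

/-- Area of the left trapezoid `{-11/5 ≤ x ≤ -13/25, |y| < 68/25 + x}`: `2856/625`. [folklore] -/
theorem klT_volume_left :
    volume (regionBetween (fun x : ℝ => -x - 68 / 25) (fun x => x + 68 / 25)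
      (Set.Icc (-(11 / 5)) (-(13 / 25)))) = ENNReal.ofReal (2856 / 625) := by
  rw [Measure.volume_eq_prod, volume_regionBetween_eq_integral
    (Continuous.integrableOn_Icc (by fun_prop)) (Continuous.integrableOn_Icc (by fun_prop))
    measurableSet_Icc (fun x hx => by simp only [Set.mem_Icc] at hx; linarith)]
  congr 1
  have hfun : ((fun x : ℝ => x + 68 / 25) - fun x : ℝ => -x - 68 / 25) =
      fun x => (136 / 25 : ℝ) + 2 * x := by
    funext x
    simp only [Pi.sub_apply]
    ring
  rw [hfun, integral_Icc_eq_integral_Ioc, ← intervalIntegral.integral_of_le (by norm_num),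
    klT_integral_left]

/-- Total area of the three pieces: at most `572/125 + 2856/625 + 2856/625 = 8572/625`.
[folklore] -/
theorem klT_volume_pieces_le :
    volume
      ((Set.Ioo (-(13 / 25 : ℝ)) (13 / 25) ×ˢ Set.Ioo (-(11 / 5 : ℝ)) (11 / 5)) ∪
        regionBetween (fun x : ℝ => x - 68 / 25) (fun x => 68 / 25 - x)
          (Set.Icc (13 / 25) (11 / 5)) ∪
        regionBetween (fun x : ℝ => -x - 68 / 25) (fun x => x + 68 / 25)
          (Set.Icc (-(11 / 5)) (-(13 / 25)))) ≤ ENNReal.ofReal (8572 / 625) := by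
  refine (measure_union_le _ _).trans ?_
  refine (add_le_add (measure_union_le _ _) le_rfl).trans ?_
  rw [klT_volume_box, klT_volume_right, klT_volume_left, ← ENNReal.ofReal_add (by norm_num)
    (by norm_num), ← ENNReal.ofReal_add (by norm_num) (by norm_num)]
  exact ENNReal.ofReal_le_ofReal (by norm_num)

/-! ### Transport to momentum space and the stub -/

/-- The occupied volume at energy `-21/25` is at most the octagon area `8572/625 = 13.7152`
(transport by the volume-preserving coordinate map `k ↦ (k₀, k₁)`,
`measurePreserving_momentum_prod`). [folklore] -/
theorem klT_volume_occupied_le :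
    (volume ({p : Momentum | squareDispersion 1 0 p < -(21:ℝ) / 25} ∩ brillouinZone)).toReal ≤
      8572 / 625 := by
  refine ENNReal.toReal_le_of_le_ofReal (by norm_num) ?_
  refine (measure_mono klT_occupied_subset_preimage).trans ?_
  rw [measurePreserving_momentum_prod.measure_preimage klT_measurableSet_pieces.nullMeasurableSet]
  exact klT_volume_pieces_le

/-- **Stub `stub_fillingBelowSevenTenths`**: at `μ = -21/25` the free-band filling is `< 7/10`:
the Fermi sea `{cos x + cos y > 21/50}` lies in the octagon `{|x|, |y| < 11/5, |x| + |y| < 68/25}`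
of area `8572/625 = 13.7152 < 1.4 π²`, so `n(-21/25) = 2 vol / (2π)² < 7/10` (`π > 3.1415`).
[folklore] -/
theorem stub_fillingBelowSevenTenths :
    KohnLuttinger.filling (squareDispersion 1 0) (-(21:ℝ) / 25) < 7 / 10 := by
  rw [kl_mu_filling_eq]
  have hV := klT_volume_occupied_le
  have hpi := Real.pi_gt_d4
  have hpi2 : (3.1415 : ℝ) * 3.1415 < Real.pi * Real.pi :=
    mul_self_lt_mul_self (by norm_num) hpi
  rw [div_lt_iff₀ (by positivity)]
  nlinarith

end Summit.HubbardSuperconductivity.HubbardSuperconductivity.Theorems
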